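import Summits.AtomisticToContinuum.HydrodynamicLimit.Theorems.ImplosionDichotomyDenseExcursionConeDefs

/-!
# The self-similar ansatz solves the ideal monatomic Euler system (line `kidder-knob-melnikov`,
# stub `stub_memberCore`)

Helper file (`--supports stmt-AtomisticToContinuum-12586`) for the registered stub
`stub_memberCore : HsEulerConeLocality → ProjectiveCovariance → MemberCore` of the crux
`Summit.AtomisticToContinuum.HydrodynamicLimit.Theses.ImplosionDichotomy.DenseExcursion`.

**Content.** The chart fields of the unsheared knob member (`KnobFamily.selfSimilar`), i.e. the tree's
`ssScalar T r (−3(1−1/r)) Pf` (density), `ssVel T r Uf` (velocity), `ssScalar T r (2(1/r−1)) Qf`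
(temperature), solve the primitive ideal monatomic Euler system `AthermalEulerAt (fun _ => 1)` at every
`(t, y)` with `t < T`, PROVIDED the radial profile fields satisfy the three stationary self-similar equations
in vector form (the conclusion of `memberCore_profileEqs`, sibling file `…MemberCoreProfile.lean`).
Pure chain rule (`hasDerivAt_ssForm`, `hasFDerivAt_ssForm`): writing `l = T − t`, `e = l^{−1/r}`,
`ỹ = e y`, every field is `l^p · G(ỹ)`; its time derivative is `l^p l⁻¹ (−p G + r⁻¹ DG(ỹ) ỹ)` and its space
derivative `l^p e DG(ỹ)`; the exponents `p_ρ = −3(1−1/r)`, `p_u = 1/r − 1`, `p_θ = 2(1/r − 1)` make each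
residual `l^{k}` times the corresponding profile residual (`l^{p_u} e = l⁻¹`, `l^{p_θ} e = l^{p_u} l⁻¹`).
This is the `(ρ, u, θ)` analogue of the tree's `CaolaboraEtAl2025.uσ_system_of_ansatz`.
-/

noncomputable section

open Set Filter Topology InnerProductSpace
open scoped ContDiff RealInnerProductSpace

namespace Summit.AtomisticToContinuum.HydrodynamicLimit.Theorems.KidderKnobMelnikov

open Literature.MathematicalPhysics.KineticTheory (V3)

namespace MemberCoreProof

/-! ## Calculus of the self-similar form `(t, y) ↦ (T − t)^p • G((T − t)^{−1/r} y)` -/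

section SSForm

variable {E : Type*} [NormedAddCommGroup E] [NormedSpace ℝ E] {T r t : ℝ}

/-- `d/dt (T − t)^p = −p (T−t)^p (T−t)⁻¹` for `t < T`. [folklore] -/
theorem hasDerivAt_rpow_sub (ht : t < T) (p : ℝ) :
    HasDerivAt (fun τ => (T - τ) ^ p) (-(p * ((T - t) ^ p * (T - t)⁻¹))) t := by
  have hl : T - t ≠ 0 := (sub_pos.mpr ht).ne'
  have h1 : HasDerivAt (fun τ => T - τ) (-1) t := by simpa using (hasDerivAt_id t).const_sub T
  refine (h1.rpow_const (p := p) (Or.inl hl)).congr_deriv ?_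
  rw [Real.rpow_sub_one hl, div_eq_mul_inv]
  ring

/-- Time derivative of the self-similar form: for `G` differentiable at `ỹ = (T−t)^{−1/r} y`,
`d/dt [(T−τ)^p G((T−τ)^{−1/r} y)] = (T−t)^p • DG(ỹ)((r⁻¹(T−t)⁻¹(T−t)^{−1/r}) y) − (p (T−t)^p (T−t)⁻¹) • G(ỹ)`.
[folklore] -/
theorem hasDerivAt_ssForm (ht : t < T) (p : ℝ) {G : V3 → E} (y : V3)
    (hG : DifferentiableAt ℝ G (((T - t) ^ (-(1 / r))) • y)) :
    HasDerivAt (fun τ => (T - τ) ^ p • G (((T - τ) ^ (-(1 / r))) • y))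
      ((T - t) ^ p • fderiv ℝ G (((T - t) ^ (-(1 / r))) • y)
          ((r⁻¹ * (T - t)⁻¹ * (T - t) ^ (-(1 / r))) • y) +
        (-(p * ((T - t) ^ p * (T - t)⁻¹))) • G (((T - t) ^ (-(1 / r))) • y)) t := by
  have hscale : HasDerivAt (fun τ => (T - τ) ^ (-(1 / r))) (r⁻¹ * (T - t)⁻¹ * (T - t) ^ (-(1 / r))) t := by
    refine (hasDerivAt_rpow_sub ht (-(1 / r))).congr_deriv ?_
    ring
  have hin : HasDerivAt (fun τ => ((T - τ) ^ (-(1 / r))) • y)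
      ((r⁻¹ * (T - t)⁻¹ * (T - t) ^ (-(1 / r))) • y) t := hscale.smul_const y
  exact (hasDerivAt_rpow_sub ht p).smul (hG.hasFDerivAt.comp_hasDerivAt t hin)

/-- Space derivative of the self-similar form: `D_y [(T−t)^p G((T−t)^{−1/r} y)] = (T−t)^p (T−t)^{−1/r} DG(ỹ)`.
[folklore] -/
theorem hasFDerivAt_ssForm (p : ℝ) {G : V3 → E} (y : V3)
    (hG : DifferentiableAt ℝ G (((T - t) ^ (-(1 / r))) • y)) :
    HasFDerivAt (fun z : V3 => (T - t) ^ p • G (((T - t) ^ (-(1 / r))) • z))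
      ((T - t) ^ p • (((T - t) ^ (-(1 / r))) • fderiv ℝ G (((T - t) ^ (-(1 / r))) • y))) y := by
  have hin : HasFDerivAt (fun z : V3 => ((T - t) ^ (-(1 / r))) • z)
      (((T - t) ^ (-(1 / r))) • ContinuousLinearMap.id ℝ V3) y :=
    (hasFDerivAt_id y).fun_const_smul _
  have hcomp : HasFDerivAt (fun z : V3 => G (((T - t) ^ (-(1 / r))) • z))
      (((T - t) ^ (-(1 / r))) • fderiv ℝ G (((T - t) ^ (-(1 / r))) • y)) y := by
    refine (hG.hasFDerivAt.comp y hin).congr_fderiv ?_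
    ext v
    simp
  exact hcomp.const_smul _

/-- `l^{1/r − 1} · l^{−1/r} = l⁻¹` (`l > 0`). [folklore] -/
theorem rpow_velocity_mul_scale {l : ℝ} (hl : 0 < l) (r : ℝ) : l ^ (1 / r - 1) * l ^ (-(1 / r)) = l⁻¹ := by
  rw [← Real.rpow_add hl, ← Real.rpow_neg_one]
  congr 1
  ring

/-- `l^{2(1/r − 1)} · l^{−1/r} = l^{1/r − 1} · l⁻¹` (`l > 0`). [folklore] -/
theorem rpow_temperature_mul_scale {l : ℝ} (hl : 0 < l) (r : ℝ) :
    l ^ (2 * (1 / r - 1)) * l ^ (-(1 / r)) = l ^ (1 / r - 1) * l⁻¹ := by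
  rw [← Real.rpow_add hl, ← Real.rpow_neg_one, ← Real.rpow_add hl]
  congr 1
  ring

end SSForm

/-! ## Module algebra of the three residuals -/

section Algebra

/-- Momentum: the physical residual is `(A_ρ A_u l⁻¹)` times the profile residual, modulo the two power
identities `A_u e = l⁻¹`, `A_θ e = A_u l⁻¹`. [folklore] -/
theorem ss_momentum_alg (L : V3 →L[ℝ] V3) (u0 gP gQ y : V3) {p0 q0 r AP AU AQ e li : ℝ}
    (hc : AU * e = li) (hd : AQ * e = AU * li) :
    (AP * p0) • ((AU • L ((r⁻¹ * li * e) • y) + (-((1 / r - 1) * (AU * li))) • u0) +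
        (AU • (e • L)) (AU • u0)) +
      (AQ * q0) • ((AP * e) • gP) + (AP * p0) • ((AQ * e) • gQ) =
    (AP * AU * li) • (p0 • ((1 - 1 / r) • u0 + L ((1 / r) • (e • y) + u0)) + q0 • gP + p0 • gQ) := by
  rw [← sub_eq_zero]
  have key : (AP * p0) • ((AU • L ((r⁻¹ * li * e) • y) + (-((1 / r - 1) * (AU * li))) • u0) +
        (AU • (e • L)) (AU • u0)) +
      (AQ * q0) • ((AP * e) • gP) + (AP * p0) • ((AQ * e) • gQ) -
      (AP * AU * li) • (p0 • ((1 - 1 / r) • u0 + L ((1 / r) • (e • y) + u0)) + q0 • gP + p0 • gQ) =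
      (AP * p0 * AU * (AU * e - li)) • L u0 + (AP * q0 * (AQ * e - AU * li)) • gP +
        (AP * p0 * (AQ * e - AU * li)) • gQ := by
    simp only [map_add, map_smul, smul_apply]
    module
  rw [key, hc, hd, sub_self, sub_self]
  simp

end Algebra

/-! ## The ansatz solves the ideal system -/

section Ansatz

variable {T r : ℝ} {Pf Uf Qf : ℝ → ℝ}

/-- On `{t < T}` the tree's scalar chart field `ssScalar` is the self-similar form of the radial field.
[folklore] -/
theorem ssScalar_eq_ssForm {t : ℝ} (ht : t < T) (p : ℝ) (S : ℝ → ℝ) (y : V3) :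
    ssScalar T r p S t y = (T - t) ^ p • (fun z : V3 => S ‖z‖) (((T - t) ^ (-(1 / r))) • y) := by
  simp only [ssScalar, smul_eq_mul, norm_rpow_neg_smul ht]

/-- On `{t < T}` the tree's velocity chart field `ssVel` is the self-similar form of the radial velocity
field. [folklore] -/
theorem ssVel_eq_ssForm {t : ℝ} (ht : t < T) (U : ℝ → ℝ) (y : V3) :
    ssVel T r U t y = (T - t) ^ (1 / r - 1) • (fun z : V3 => (U ‖z‖ / ‖z‖) • z) (((T - t) ^ (-(1 / r))) • y) :=
  selfSimilar_velocity_eq U ht r y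

/-- **The self-similar ansatz of `KnobFamily.selfSimilar` solves the ideal monatomic Euler system.** If the
radial profile fields `P̄ = Pf(|·|)`, `Ū = Uf(|·|)·/|·|`, `Q̄ = Qf(|·|)` are `C¹` on `ℝ³` and satisfy the
three stationary self-similar equations in vector form (conclusion of `memberCore_profileEqs`), then for
every `t < T` and every `y ∈ ℝ³` the chart fields `ssScalar T r (−3(1−1/r)) Pf`, `ssScalar T r (2(1/r−1)) Qf`,
`ssVel T r Uf` satisfy `AthermalEulerAt (fun _ => 1)` at `(t, y)`. [folklore] -/
theorem athermalEulerAt_selfSimilar (hPc : ContDiff ℝ 1 fun y : V3 => Pf ‖y‖)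
    (hUc : ContDiff ℝ 1 fun y : V3 => (Uf ‖y‖ / ‖y‖) • y) (hQc : ContDiff ℝ 1 fun y : V3 => Qf ‖y‖)
    (hE : ∀ y : V3,
      (3 * (1 - 1 / r) * Pf ‖y‖ +
          fderiv ℝ (fun z : V3 => Pf ‖z‖) y ((1 / r) • y + (Uf ‖y‖ / ‖y‖) • y) +
        Pf ‖y‖ * ∑ i, (fderiv ℝ (fun z : V3 => (Uf ‖z‖ / ‖z‖) • z) y (EuclideanSpace.single i 1)) i = 0) ∧
      (Pf ‖y‖ • ((1 - 1 / r) • ((Uf ‖y‖ / ‖y‖) • y) +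
          fderiv ℝ (fun z : V3 => (Uf ‖z‖ / ‖z‖) • z) y ((1 / r) • y + (Uf ‖y‖ / ‖y‖) • y)) +
        Qf ‖y‖ • gradient (fun z : V3 => Pf ‖z‖) y + Pf ‖y‖ • gradient (fun z : V3 => Qf ‖z‖) y = 0) ∧
      (2 * (1 - 1 / r) * Qf ‖y‖ +
          fderiv ℝ (fun z : V3 => Qf ‖z‖) y ((1 / r) • y + (Uf ‖y‖ / ‖y‖) • y) +
        2 / 3 * Qf ‖y‖ * ∑ i, (fderiv ℝ (fun z : V3 => (Uf ‖z‖ / ‖z‖) • z) y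
          (EuclideanSpace.single i 1)) i = 0))
    {t : ℝ} (ht : t < T) (y : V3) :
    AthermalEulerAt (fun _ => 1) (ssScalar T r (-(3 * (1 - 1 / r))) Pf) (ssScalar T r (2 * (1 / r - 1)) Qf)
      (ssVel T r Uf) t y := by
  -- notation
  set Pb : V3 → ℝ := fun z => Pf ‖z‖ with hPb
  set Ub : V3 → V3 := fun z => (Uf ‖z‖ / ‖z‖) • z with hUb
  set Qb : V3 → ℝ := fun z => Qf ‖z‖ with hQb
  set l : ℝ := T - t with hl
  have hl0 : 0 < l := sub_pos.mpr ht
  set e : ℝ := l ^ (-(1 / r)) with he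
  set AP : ℝ := l ^ (-(3 * (1 - 1 / r))) with hAP
  set AU : ℝ := l ^ (1 / r - 1) with hAU
  set AQ : ℝ := l ^ (2 * (1 / r - 1)) with hAQ
  set yt : V3 := e • y with hyt
  have hc : AU * e = l⁻¹ := rpow_velocity_mul_scale hl0 r
  have hd : AQ * e = AU * l⁻¹ := rpow_temperature_mul_scale hl0 r
  have hPd : DifferentiableAt ℝ Pb yt := (hPc.differentiable one_ne_zero).differentiableAt
  have hUd : DifferentiableAt ℝ Ub yt := (hUc.differentiable one_ne_zero).differentiableAt
  have hQd : DifferentiableAt ℝ Qb yt := (hQc.differentiable one_ne_zero).differentiableAt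
  -- the slices near `t` (time derivatives) and at `t` (space derivatives), in the atoms above
  have hnhd : ∀ᶠ τ in 𝓝 t, τ < T := Iio_mem_nhds ht
  have dP : HasDerivAt (fun τ => ssScalar T r (-(3 * (1 - 1 / r))) Pf τ y)
      (AP * fderiv ℝ Pb yt ((r⁻¹ * l⁻¹ * e) • y) + -(-(3 * (1 - 1 / r)) * (AP * l⁻¹)) * Pb yt) t :=
    (hasDerivAt_ssForm ht _ y hPd).congr_of_eventuallyEq (hnhd.mono fun τ hτ => ssScalar_eq_ssForm hτ _ _ _)
  have dQ : HasDerivAt (fun τ => ssScalar T r (2 * (1 / r - 1)) Qf τ y)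
      (AQ * fderiv ℝ Qb yt ((r⁻¹ * l⁻¹ * e) • y) + -(2 * (1 / r - 1) * (AQ * l⁻¹)) * Qb yt) t :=
    (hasDerivAt_ssForm ht _ y hQd).congr_of_eventuallyEq (hnhd.mono fun τ hτ => ssScalar_eq_ssForm hτ _ _ _)
  have dU : HasDerivAt (fun τ => ssVel T r Uf τ y)
      (AU • fderiv ℝ Ub yt ((r⁻¹ * l⁻¹ * e) • y) + (-((1 / r - 1) * (AU * l⁻¹))) • Ub yt) t :=
    (hasDerivAt_ssForm ht _ y hUd).congr_of_eventuallyEq (hnhd.mono fun τ hτ => ssVel_eq_ssForm hτ _ _)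
  have sP : ssScalar T r (-(3 * (1 - 1 / r))) Pf t =
      fun z => (T - t) ^ (-(3 * (1 - 1 / r))) • Pb (((T - t) ^ (-(1 / r))) • z) :=
    funext fun z => ssScalar_eq_ssForm ht _ _ _
  have sQ : ssScalar T r (2 * (1 / r - 1)) Qf t =
      fun z => (T - t) ^ (2 * (1 / r - 1)) • Qb (((T - t) ^ (-(1 / r))) • z) :=
    funext fun z => ssScalar_eq_ssForm ht _ _ _
  have sU : ssVel T r Uf t = fun z => (T - t) ^ (1 / r - 1) • Ub (((T - t) ^ (-(1 / r))) • z) :=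
    funext fun z => ssVel_eq_ssForm ht _ _
  have fP : HasFDerivAt (ssScalar T r (-(3 * (1 - 1 / r))) Pf t) (AP • (e • fderiv ℝ Pb yt)) y := by
    rw [sP]; exact hasFDerivAt_ssForm _ y hPd
  have fQ : HasFDerivAt (ssScalar T r (2 * (1 / r - 1)) Qf t) (AQ • (e • fderiv ℝ Qb yt)) y := by
    rw [sQ]; exact hasFDerivAt_ssForm _ y hQd
  have fU : HasFDerivAt (ssVel T r Uf t) (AU • (e • fderiv ℝ Ub yt)) y := by
    rw [sU]; exact hasFDerivAt_ssForm _ y hUd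
  have gP : gradient (ssScalar T r (-(3 * (1 - 1 / r))) Pf t) y = (AP * e) • gradient Pb yt := by
    change (toDual ℝ V3).symm (fderiv ℝ _ y) = (AP * e) • (toDual ℝ V3).symm (fderiv ℝ Pb yt)
    rw [fP.fderiv, smul_smul, map_smulₛₗ, starRingEnd_apply, star_trivial]
  have gQ : gradient (ssScalar T r (2 * (1 / r - 1)) Qf t) y = (AQ * e) • gradient Qb yt := by
    change (toDual ℝ V3).symm (fderiv ℝ _ y) = (AQ * e) • (toDual ℝ V3).symm (fderiv ℝ Qb yt)
    rw [fQ.fderiv, smul_smul, map_smulₛₗ, starRingEnd_apply, star_trivial]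
  have vP : ssScalar T r (-(3 * (1 - 1 / r))) Pf t y = AP * Pb yt := ssScalar_eq_ssForm ht _ _ _
  have vQ : ssScalar T r (2 * (1 / r - 1)) Qf t y = AQ * Qb yt := ssScalar_eq_ssForm ht _ _ _
  have vU : ssVel T r Uf t y = AU • Ub yt := ssVel_eq_ssForm ht _ _
  have htr : ∑ i, ((AU • (e • fderiv ℝ Ub yt)) (EuclideanSpace.single i 1)) i =
      AU * e * ∑ i, (fderiv ℝ Ub yt (EuclideanSpace.single i 1)) i := by
    rw [Finset.mul_sum]
    refine Finset.sum_congr rfl fun i _ => ?_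
    simp only [smul_apply, PiLp.smul_apply, smul_eq_mul]
    ring
  obtain ⟨hE1, hE2, hE3⟩ := hE yt
  have hE1' : 3 * (1 - 1 / r) * Pb yt + fderiv ℝ Pb yt ((1 / r) • yt + Ub yt) +
      Pb yt * ∑ i, (fderiv ℝ Ub yt (EuclideanSpace.single i 1)) i = 0 := hE1
  have hE2' : Pb yt • ((1 - 1 / r) • Ub yt + fderiv ℝ Ub yt ((1 / r) • yt + Ub yt)) +
      Qb yt • gradient Pb yt + Pb yt • gradient Qb yt = 0 := hE2
  have hE3' : 2 * (1 - 1 / r) * Qb yt + fderiv ℝ Qb yt ((1 / r) • yt + Ub yt) +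
      2 / 3 * Qb yt * ∑ i, (fderiv ℝ Ub yt (EuclideanSpace.single i 1)) i = 0 := hE3
  rw [athermalEulerAt_one_iff, dP.deriv, dQ.deriv, dU.deriv, fP.fderiv, fQ.fderiv, fU.fderiv, gP, gQ, vP, vQ,
    vU, htr]
  refine ⟨?_, ?_, ?_⟩
  · -- mass
    rw [hyt] at hE1' ⊢
    simp only [map_add, map_smul, smul_apply, smul_eq_mul] at hE1' ⊢
    linear_combination (AP * l⁻¹) * hE1' +
      (AP * fderiv ℝ Pb (e • y) (Ub (e • y)) +
        AP * Pb (e • y) * ∑ i, (fderiv ℝ Ub (e • y) (EuclideanSpace.single i 1)) i) * hc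
  · -- momentum
    rw [ss_momentum_alg (fderiv ℝ Ub yt) (Ub yt) (gradient Pb yt) (gradient Qb yt) y hc hd, ← hyt, hE2',
      smul_zero]
  · -- temperature
    rw [hyt] at hE3' ⊢
    simp only [map_add, map_smul, smul_apply, smul_eq_mul] at hE3' ⊢
    linear_combination (AQ * l⁻¹) * hE3' +
      (AQ * fderiv ℝ Qb (e • y) (Ub (e • y)) +
        2 / 3 * (AQ * Qb (e • y)) * ∑ i, (fderiv ℝ Ub (e • y) (EuclideanSpace.single i 1)) i) * hc

end Ansatz

end MemberCoreProof

open MemberCoreProof in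
/-- **The self-similar ansatz of `KnobFamily.selfSimilar` solves the ideal monatomic Euler system** (member `0`
of the knob on its core chart, extended to all of `ℝ³` and all `t < T`). For radial profile fields
`Pf(|·|)`, `Uf(|·|)·/|·|`, `Qf(|·|)` of class `C¹` on `ℝ³` satisfying the three stationary self-similar
equations in vector form (conclusion of `memberCore_profileEqs`), the chart fields
`ρ = (T−t)^{−3(1−1/r)} Pf(|y|/(T−t)^{1/r})` (`ssScalar`), `u = (T−t)^{1/r−1} Uf(·) y/|y|` (`ssVel`),
`θ = (T−t)^{2(1/r−1)} Qf(·)` satisfy `AthermalEulerAt (fun _ => 1)` — continuity, momentum with `p = ρθ`,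
temperature with `e = 3θ/2` — at every `(t, y)` with `t < T`. [folklore] -/
theorem memberCore_selfSimilar_solves : ∀ (T r : ℝ) (Pf Uf Qf : ℝ → ℝ),
    ContDiff ℝ 1 (fun y : V3 => Pf ‖y‖) → ContDiff ℝ 1 (fun y : V3 => (Uf ‖y‖ / ‖y‖) • y) →
    ContDiff ℝ 1 (fun y : V3 => Qf ‖y‖) →
    (∀ y : V3,
      (3 * (1 - 1 / r) * Pf ‖y‖ +
          fderiv ℝ (fun z : V3 => Pf ‖z‖) y ((1 / r) • y + (Uf ‖y‖ / ‖y‖) • y) +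
        Pf ‖y‖ * ∑ i, (fderiv ℝ (fun z : V3 => (Uf ‖z‖ / ‖z‖) • z) y (EuclideanSpace.single i 1)) i = 0) ∧
      (Pf ‖y‖ • ((1 - 1 / r) • ((Uf ‖y‖ / ‖y‖) • y) +
          fderiv ℝ (fun z : V3 => (Uf ‖z‖ / ‖z‖) • z) y ((1 / r) • y + (Uf ‖y‖ / ‖y‖) • y)) +
        Qf ‖y‖ • gradient (fun z : V3 => Pf ‖z‖) y + Pf ‖y‖ • gradient (fun z : V3 => Qf ‖z‖) y = 0) ∧
      (2 * (1 - 1 / r) * Qf ‖y‖ +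
          fderiv ℝ (fun z : V3 => Qf ‖z‖) y ((1 / r) • y + (Uf ‖y‖ / ‖y‖) • y) +
        2 / 3 * Qf ‖y‖ * ∑ i, (fderiv ℝ (fun z : V3 => (Uf ‖z‖ / ‖z‖) • z) y
          (EuclideanSpace.single i 1)) i = 0)) →
    ∀ t, t < T → ∀ y : V3,
      AthermalEulerAt (fun _ => 1) (ssScalar T r (-(3 * (1 - 1 / r))) Pf) (ssScalar T r (2 * (1 / r - 1)) Qf)
        (ssVel T r Uf) t y :=
  fun _ _ _ _ _ hP hU hQ hE _ ht y => athermalEulerAt_selfSimilar hP hU hQ hE ht y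

end Summit.AtomisticToContinuum.HydrodynamicLimit.Theorems.KidderKnobMelnikov

end
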